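import Mathlib
import Summits.CriticalPhenomena.PercolationContinuityZ3.Theorems.PercNearOneGluingNoHeavyLowerTailFatMinorityMonoReduction
import HarnessLib

/-!
# `NoHeavyLowerTail` (stmt-CriticalPhenomena-4575), line fat-minority-linear — THEOREM A of the notes in the tree: the up-set star
# inequality (UT4 + QUT4, every admissible threshold) for observers with AT MOST TWO ports, unconditionally (route task `nh-dp-fatminority`, gen 11)

Notation of `…FatMinorityInduction`.  `upsetStar_target_of_caseII` reduces TARGET to its Case-II instances with no singleton member of `𝒰`; when
`|A| ≤ 2` every such instance has a COMMON port (a member `B ⊆ A` with `|B| ≥ 2` is `A` itself), and Case II at a common port gives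
`μ({c↔b} ∩ U) ≤ μ({o↔b} ∩ U)` (`mono_of_commonPort`, BHK Thm 1.5), hence TARGET with any `t ≥ 0`.  Since deleting a port keeps `|A| ≤ 2`, the induction
closes: `upsetStar_target_card_le_two` — for every weighting on `Fin n`, every observer `o ∉ A` isolated off `A` (no loop) with `|A| ≤ 2`, every up-set
`𝒰 ∌ ∅`, every `c ≠ o` and every admissible `t`:  `μ({c↔b} ∩ U) − μ({o↔b} ∩ U) ≤ t·μ(U)`  (PROOF-UT4-upto3ports.md, THEOREM A; there by hand).  No definitions.
-/

namespace Summit.CriticalPhenomena.PercolationContinuityZ3.Theorems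

open MeasureTheory Set
open Literature.Probability.LatticeModels (prodBernoulli)
open Literature.Probability.Percolation

noncomputable section
open scoped Classical

variable {n : ℕ}

/-- **Case II with a common port gives TARGET.**  If every member of `𝒰` contains `a ∈ A` and `μ₁ᵃ(c↔b) ≤ μ₁ᵃ(a↔b)`, then
`μ({c↔b} ∩ U) − μ({o↔b} ∩ U) ≤ t·μ(U)` for every `t ≥ 0`. [cite: VandenbergHaggstromKahn2005, Thm. 1.5 (p. 7); KozmaNitzan2024, Lemma 3 p. 6] -/
theorem target_of_commonPort_caseII (w : Sym2 (Fin n) → unitInterval) (A : Finset (Fin n)) (o a c b : Fin n)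
    (hoA : o ∉ A) (haA : a ∈ A) (𝒰 : Finset (Finset (Fin n))) (h𝒰A : 𝒰 ⊆ A.powerset)
    (hcommon : ∀ B ∈ 𝒰, a ∈ B)
    (hII : (prodBernoulli (Function.update w s(o, a) 1)).real (openConn c b) ≤
      (prodBernoulli (Function.update w s(o, a) 1)).real (openConn a b)) (t : ℝ) (ht : 0 ≤ t) :
    (prodBernoulli w).real (openConn c b ∩ {ω | ∃ B ∈ 𝒰, ∀ u ∈ B, s(o, u) ∈ ω}) -
        (prodBernoulli w).real (openConn o b ∩ {ω | ∃ B ∈ 𝒰, ∀ u ∈ B, s(o, u) ∈ ω}) ≤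
      t * (prodBernoulli w).real {ω | ∃ B ∈ 𝒰, ∀ u ∈ B, s(o, u) ∈ ω} := by
  have h := mono_of_commonPort w A o a c b hoA haA 𝒰 h𝒰A hcommon hII
  have hU : 0 ≤ (prodBernoulli w).real {ω : BondConfig (Fin n) | ∃ B ∈ 𝒰, ∀ u ∈ B, s(o, u) ∈ ω} :=
    measureReal_nonneg
  nlinarith [h, hU, ht]

/-- **THEOREM A (≤ 2 ports): the up-set star inequality, unconditionally.**  For every weighting on `Fin n`, every observer `o ∉ A` whose
positive-weight pairs go to `A` (no loop) with `|A| ≤ 2`, every up-set `𝒰 ⊆ 𝒫(A)` with `∅ ∉ 𝒰`, every `c ≠ o` and every threshold `t ≥ 0` with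
`μ(c↔b) − μ(v↔b) ≤ t` for all `v ∈ A`:  `μ({c↔b} ∩ U) − μ({o↔b} ∩ U) ≤ t·μ(U)`.  (UT4 is `t = 0` under Kozma–Nitzan's hypothesis `μ(c↔b) ≤ min_v μ(v↔b)`;
QUT4 is `t = (μ(c↔b) − min_v μ(v↔b))⁺`.)
[cite: KozmaNitzan2024, Thm. 4 p. 13, Lemma 3 p. 6, Lemma 4 p. 9; VandenbergHaggstromKahn2005, Thm. 1.4/1.5 (p. 7); proof: route notes gen 8 THEOREM A / gen 11] -/
theorem upsetStar_target_card_le_two (w : Sym2 (Fin n) → unitInterval) (A : Finset (Fin n)) (o b c : Fin n)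
    (hA : A.card ≤ 2) (hoA : o ∉ A) (hiso : ∀ u, u ≠ o → u ∉ A → w s(o, u) = 0) (hloop : w s(o, o) = 0)
    (𝒰 : Finset (Finset (Fin n))) (h𝒰A : 𝒰 ⊆ A.powerset) (h0 : ∅ ∉ 𝒰)
    (hup : ∀ B ∈ 𝒰, ∀ B' ∈ A.powerset, B ⊆ B' → B' ∈ 𝒰) (hco : c ≠ o) (t : ℝ) (ht : 0 ≤ t)
    (hgap : ∀ v ∈ A, (prodBernoulli w).real (openConn c b) - (prodBernoulli w).real (openConn v b) ≤ t) :
    (prodBernoulli w).real (openConn c b ∩ {ω | ∃ B ∈ 𝒰, ∀ u ∈ B, s(o, u) ∈ ω}) -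
        (prodBernoulli w).real (openConn o b ∩ {ω | ∃ B ∈ 𝒰, ∀ u ∈ B, s(o, u) ∈ ω}) ≤
      t * (prodBernoulli w).real {ω | ∃ B ∈ 𝒰, ∀ u ∈ B, s(o, u) ∈ ω} := by
  -- Case II with no singleton on ≤ 2 ports: a common port
  have hC2 : ∀ (w' : Sym2 (Fin n) → unitInterval) (A' : Finset (Fin n)) (c' : Fin n)
      (𝒰' : Finset (Finset (Fin n))) (t' : ℝ),
      o ∉ A' → (∀ u, u ≠ o → u ∉ A' → w' s(o, u) = 0) → w' s(o, o) = 0 → c' ≠ o →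
      𝒰' ⊆ A'.powerset → ∅ ∉ 𝒰' → (∀ B ∈ 𝒰', ∀ B' ∈ A'.powerset, B ⊆ B' → B' ∈ 𝒰') →
      (∀ z ∈ A', ({z} : Finset (Fin n)) ∉ 𝒰') →
      (∀ z ∈ A', (prodBernoulli (Function.update w' s(o, z) 1)).real (openConn c' b) <
        (prodBernoulli (Function.update w' s(o, z) 1)).real (openConn z b)) →
      0 ≤ t' → (∀ v ∈ A', (prodBernoulli w').real (openConn c' b) - (prodBernoulli w').real (openConn v b) ≤ t') →
      A'.card ≤ 2 →
      (prodBernoulli w').real (openConn c' b ∩ {ω | ∃ B ∈ 𝒰', ∀ u ∈ B, s(o, u) ∈ ω}) -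
          (prodBernoulli w').real (openConn o b ∩ {ω | ∃ B ∈ 𝒰', ∀ u ∈ B, s(o, u) ∈ ω}) ≤
        t' * (prodBernoulli w').real {ω | ∃ B ∈ 𝒰', ∀ u ∈ B, s(o, u) ∈ ω} := by
    intro w' A' c' 𝒰' t' hoA' hiso' hloop' hco' h𝒰A' h0' hup' hsing hII ht' hgap' hA'
    rcases 𝒰'.eq_empty_or_nonempty with he | ⟨B₀, hB₀⟩
    · -- empty family: `U = ∅`
      have hU : {ω : BondConfig (Fin n) | ∃ B ∈ 𝒰', ∀ u ∈ B, s(o, u) ∈ ω} = ∅ := by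
        ext ω; simp [he]
      simp [hU]
    · -- a member has ≥ 2 elements inside `A'` with `|A'| ≤ 2`, so it is `A'`, and so is every member
      have hmem : ∀ B ∈ 𝒰', B = A' := by
        intro B hB
        have hBA : B ⊆ A' := Finset.mem_powerset.1 (h𝒰A' hB)
        have hB2 : 2 ≤ B.card := by
          by_contra hlt
          push Not at hlt
          interval_cases hcB : B.card
          · exact h0' (Finset.card_eq_zero.1 hcB ▸ hB)
          · obtain ⟨z, hz⟩ := Finset.card_eq_one.1 hcB
            subst hz
            exact hsing z (hBA (Finset.mem_singleton_self z)) hB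
        exact Finset.eq_of_subset_of_card_le hBA (hA'.trans hB2)
      have hA'ne : A'.Nonempty := by
        rw [← hmem B₀ hB₀]
        exact Finset.nonempty_iff_ne_empty.2 (fun h => h0' (h ▸ hB₀))
      obtain ⟨a, haA'⟩ := hA'ne
      have hcommon : ∀ B ∈ 𝒰', a ∈ B := fun B hB => (hmem B hB).symm ▸ haA'
      exact target_of_commonPort_caseII w' A' o a c' b hoA' haA' 𝒰' h𝒰A' hcommon (hII a haA').le t' ht'
  -- the induction of `upsetStar_target_of_caseII`, run with the extra invariant `|A| ≤ 2` (it only deletes ports)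
  -- we re-run it by strong induction on `|A|` using `upsetStar_port_step`
  suffices key : ∀ (k : ℕ) (w : Sym2 (Fin n) → unitInterval) (A : Finset (Fin n)), A.card ≤ k → A.card ≤ 2 → o ∉ A →
      (∀ u, u ≠ o → u ∉ A → w s(o, u) = 0) → w s(o, o) = 0 →
      ∀ 𝒰 : Finset (Finset (Fin n)), 𝒰 ⊆ A.powerset → ∅ ∉ 𝒰 →
        (∀ B ∈ 𝒰, ∀ B' ∈ A.powerset, B ⊆ B' → B' ∈ 𝒰) →
        ∀ c : Fin n, c ≠ o → ∀ t : ℝ, 0 ≤ t →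
          (∀ v ∈ A, (prodBernoulli w).real (openConn c b) - (prodBernoulli w).real (openConn v b) ≤ t) →
          (prodBernoulli w).real (openConn c b ∩ {ω | ∃ B ∈ 𝒰, ∀ u ∈ B, s(o, u) ∈ ω}) -
              (prodBernoulli w).real (openConn o b ∩ {ω | ∃ B ∈ 𝒰, ∀ u ∈ B, s(o, u) ∈ ω}) ≤
            t * (prodBernoulli w).real {ω | ∃ B ∈ 𝒰, ∀ u ∈ B, s(o, u) ∈ ω} from
    key A.card w A le_rfl hA hoA hiso hloop 𝒰 h𝒰A h0 hup c hco t ht hgap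
  intro k
  induction k with
  | zero =>
    intro w A hA _ hoA hiso hloop 𝒰 h𝒰A h0 hup c hco t ht0 hgap
    have hAe : A = ∅ := Finset.card_eq_zero.1 (Nat.le_zero.1 hA)
    have h𝒰e : 𝒰 = ∅ := by
      refine Finset.eq_empty_of_forall_notMem fun B hB => h0 ?_
      have hBA := Finset.mem_powerset.1 (h𝒰A hB)
      rw [hAe, Finset.subset_empty] at hBA
      exact hBA ▸ hB
    have hU : {ω : BondConfig (Fin n) | ∃ B ∈ 𝒰, ∀ u ∈ B, s(o, u) ∈ ω} = ∅ := by
      ext ω; simp [h𝒰e]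
    simp [hU]
  | succ k ih =>
    intro w A hA hA2 hoA hiso hloop 𝒰 h𝒰A h0 hup c hco t ht0 hgap
    have hIH' : ∀ z ∈ A, ∀ c' : Fin n, c' ≠ o → ∀ t' : ℝ, 0 ≤ t' →
        (∀ v ∈ A.erase z, (prodBernoulli (Function.update w s(o, z) 0)).real (openConn c' b) -
            (prodBernoulli (Function.update w s(o, z) 0)).real (openConn v b) ≤ t') →
        ∀ 𝒰' : Finset (Finset (Fin n)), 𝒰' ⊆ (A.erase z).powerset → ∅ ∉ 𝒰' →
          (∀ B ∈ 𝒰', ∀ B' ∈ (A.erase z).powerset, B ⊆ B' → B' ∈ 𝒰') →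
          (prodBernoulli (Function.update w s(o, z) 0)).real
                (openConn c' b ∩ {ω | ∃ B ∈ 𝒰', ∀ u ∈ B, s(o, u) ∈ ω}) -
              (prodBernoulli (Function.update w s(o, z) 0)).real
                (openConn o b ∩ {ω | ∃ B ∈ 𝒰', ∀ u ∈ B, s(o, u) ∈ ω}) ≤
            t' * (prodBernoulli (Function.update w s(o, z) 0)).real {ω | ∃ B ∈ 𝒰', ∀ u ∈ B, s(o, u) ∈ ω} := by
      intro z hzA c' hc' t' ht' hdom 𝒰' h𝒰' h0' hup'
      have hzo : z ≠ o := fun h => hoA (h ▸ hzA)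
      have hcard : (A.erase z).card ≤ k := by rw [Finset.card_erase_of_mem hzA]; omega
      have hcard2 : (A.erase z).card ≤ 2 := (Finset.card_erase_le).trans hA2
      have hoA' : o ∉ A.erase z := fun h => hoA (Finset.mem_of_mem_erase h)
      have hiso' : ∀ u, u ≠ o → u ∉ A.erase z → Function.update w s(o, z) 0 s(o, u) = 0 := by
        intro u huo hu
        by_cases huz : u = z
        · subst huz; simp only [Function.update_self]
        · have hne : s(o, u) ≠ s(o, z) := fun h => huz (Sym2.congr_right.mp h)
          simp only [Function.update_of_ne hne]
          exact hiso u huo (fun huA => hu (Finset.mem_erase.2 ⟨huz, huA⟩))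
      have hloop' : Function.update w s(o, z) 0 s(o, o) = 0 := by
        have hne : s(o, o) ≠ s(o, z) := fun h => hzo (Sym2.congr_right.mp h).symm
        simp only [Function.update_of_ne hne]; exact hloop
      exact ih (Function.update w s(o, z) 0) (A.erase z) hcard hcard2 hoA' hiso' hloop' 𝒰' h𝒰' h0' hup' c' hc' t' ht' hdom
    by_cases hsing : ∃ z ∈ A, ({z} : Finset (Fin n)) ∈ 𝒰
    · obtain ⟨z, hzA, hz⟩ := hsing
      exact upsetStar_port_step w A o z c b hoA hzA hco hiso hloop 𝒰 h𝒰A h0 hup t ht0 hgap (Or.inl hz) (hIH' z hzA)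
    · push Not at hsing
      by_cases hI : ∃ z ∈ A, (prodBernoulli (Function.update w s(o, z) 1)).real (openConn z b) ≤
          (prodBernoulli (Function.update w s(o, z) 1)).real (openConn c b)
      · obtain ⟨z, hzA, hz⟩ := hI
        exact upsetStar_port_step w A o z c b hoA hzA hco hiso hloop 𝒰 h𝒰A h0 hup t ht0 hgap (Or.inr hz) (hIH' z hzA)
      · push Not at hI
        exact hC2 w A c 𝒰 t hoA hiso hloop hco h𝒰A h0 hup hsing hI ht0 hgap hA2

end

end Summit.CriticalPhenomena.PercolationContinuityZ3.Theorems
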